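import Mathlib
import Literature.Computability.AlgebraicComplexity.NewtonPolygonKPTTProp1Proofs
import HarnessLib

/-!
# A located literature negative for crux `TwoProducts` (stmt-ValiantsHypothesis-5906): Martínez-Sandoval–Padrol 2021,
# Theorem 6.5, is FALSE already in the plane

Honesty-ledger brick (director-valiant g11 R110 (2), merged desk RULING #226 (d) / #229 (a); lit g15 report R95, GAP-LEDGER §L row L1,
PRINT-ERRATA A51).  S. Martínez-Sandoval, A. Padrol, *The convex dimension of hypergraphs and the hypersimplicial Van Kampen–Flores
theorem*, J. Combin. Theory Ser. B 149 (2021) 23–51, doi 10.1016/j.jctb.2021.01.003 (= arXiv:1909.01189; held text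
`paper:arxiv-1909.01189`, read this session).  Their setting (p0003 L3–5): "a convex embedding of `H` into `ℝ^d` is an injective map
`f : V → ℝ^d` such that the set of `k`-barycenters `{(1/k) Σ_{v ∈ e} f(v) : e ∈ E}` is in convex position (i.e. no point is a convex
combination of the others)"; (p0004 L16) "`g_k(n,d)` [is] the maximum number of hyperedges that a `k`-uniform hypergraph on `n` vertices
that has a convex embedding into `ℝ^d` can have"; and (p0014, Theorem 6.5, published version)
"`g_k(n,d) ≤ 2 (C(n-1,d) + C(n-1,d-1) + ⋯ + C(n-1,0)) ∈ O(n^d)`."  STATUS OF THE SOURCE: the authors RETRACTED THE PROOF and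
left the STATEMENT OPEN (arXiv v3, 10 Jul 2024, comments verbatim: "The proof of Theorem 6.5 in the published version is wrong. In this
version, we update our statement and leave it as an open problem"; the halfspace step fails).  It had been proposed on the val-lit bus as a
route to `TwoProducts` with `a = 0`.

This file states the published `d = 2` case as a LOCAL proposition `MSP21_thm_6_5_dim2` (director-valiant g11 R110 (2): "the refuted
statement is a local `def` in the Theorems file (never a Literature fact)"; family form of the convexity hypothesis, so that distinct
hyperedges have DISTINCT barycentres, as the printed proof uses: "e is the only hyperedge contained in H⁺ ∩ S") and REFUTES it — a NEW
observation (val-lit-lit g15 report R95, 2026-08-28; not claimed by the source, whose v3 leaves the statement open) — from a theorem of the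
tree: `Literature.Computability.AlgebraicComplexity.KPTT.kptt_proposition1_holds` (Koiran–Portier–Tavenas–Thomassé 2015,
Prop. 1, p605422): for `b = 2` and `m = 14` there are planar 8-point sets `P_1, …, P_14` and `2^14 - 1 = 16383` convexly independent points of
`P_1 + ⋯ + P_14`.  Translate the classes apart (translations summing to `0`), take as hyperedges one transversal per such point: a
`14`-uniform hypergraph on `n = 112` vertices with a convex embedding into `ℝ²` and `16383 > 12434 = 2 (C(111,2) + C(111,1) + C(111,0))`
hyperedges with pairwise distinct barycentres (`not_MSP21_thm_6_5_dim2`).  (The same construction along `k = n/8` shows that no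
`k`-independent polynomial bound holds in the plane, which bears on the v3 open question; only the `(14, 112)` instance is formalised.)
Honest framing: a kernel negative about a published statement whose proof was retracted; it moves no rung; `TwoProducts` (5906) is OPEN;
`VP ≠ VNP` is NOT proved.  No Literature fact is created (the `def` below carries no cite tag on purpose). [folklore]
-/

noncomputable section

-- Sub = Summit single-conjunct layout: the duplicated namespace component is mandated by the tree.
set_option linter.dupNamespace false

open scoped BigOperators Pointwise

namespace Summit.ValiantsHypothesis.ValiantsHypothesis.Theorems.NewtonUnitEquations.TwoProducts.MSP21

/-- **Martínez-Sandoval–Padrol, JCTB 149 (2021) 23–51 (bib `MartinezSandovalPadrol2021`), Theorem 6.5 at `d = 2`** — published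
version; PROOF RETRACTED by the authors and the statement LEFT OPEN in arXiv:1909.01189v3 — in the paper's own terms: for every `k`-uniform
hypergraph `E` on `n` vertices and every CONVEX EMBEDDING `f : V → ℝ²` (injective, the `k`-barycentres `(1/k) Σ_{v ∈ e} f(v)` of the
hyperedges in convex position — stated in FAMILY form, so distinct hyperedges have distinct barycentres, which is how the printed proof reads
them), `#E ≤ 2 (C(n-1,2) + C(n-1,1) + C(n-1,0))`.  A LOCAL proposition (director R110 (2) typing rule), stated only to be refuted
(`not_MSP21_thm_6_5_dim2`); deliberately NOT a Literature fact and carrying no cite tag. -/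
def MSP21_thm_6_5_dim2 : Prop :=
  ∀ (n k : ℕ) (E : Finset (Finset (Fin n))), (∀ e ∈ E, e.card = k) →
    ∀ f : Fin n → (Fin 2 → ℝ), Function.Injective f →
      ConvexIndependent ℝ (fun e : ↥E => (k : ℝ)⁻¹ • ∑ v ∈ (e : Finset (Fin n)), f v) →
      E.card ≤ 2 * ((n - 1).choose 2 + (n - 1).choose 1 + (n - 1).choose 0)

/-- Convex independence of a set is invariant under a nonzero scaling. [folklore] -/
theorem convexIndependent_smul {S : Set (Fin 2 → ℝ)} (hS : ConvexIndependent ℝ (Subtype.val : S → (Fin 2 → ℝ)))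
    {a : ℝ} (ha : a ≠ 0) : ConvexIndependent ℝ (Subtype.val : ↥(a • S) → (Fin 2 → ℝ)) := by
  have h1 : ConvexIndependent ℝ (fun x : S => a • (x : Fin 2 → ℝ)) := by
    intro s x hx
    apply hS s x
    have himg : (fun x : S => a • (x : Fin 2 → ℝ)) '' s = a • (Subtype.val '' s) := by
      ext y
      simp only [Set.mem_image, Set.mem_smul_set]
      constructor
      · rintro ⟨z, hz, rfl⟩; exact ⟨z, ⟨z, hz, rfl⟩, rfl⟩
      · rintro ⟨_, ⟨z, hz, rfl⟩, rfl⟩; exact ⟨z, hz, rfl⟩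
    rw [himg, convexHull_smul] at hx
    obtain ⟨y, hy, hyx⟩ := Set.mem_smul_set.1 hx
    have : y = (x : Fin 2 → ℝ) := smul_right_injective _ ha hyx
    rwa [this] at hy
  have h2 := h1.range
  have hrange : Set.range (fun x : S => a • (x : Fin 2 → ℝ)) = a • S := by
    ext y
    simp only [Set.mem_range, Set.mem_smul_set, Subtype.exists, exists_prop]
  rwa [hrange] at h2

/-- **The published MSP21 Theorem 6.5 fails at `d = 2`** (new observation, val-lit-lit g15 R95; refuted from KPTT 2015 Prop. 1 in the
tree: `(k, n) = (14, 112)`, a 14-uniform hypergraph with an injective planar embedding whose `16383` hyperedge barycentres are pairwise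
distinct and in convex position, `2^14 - 1 = 16383 > 12434`). [folklore] -/
theorem not_MSP21_thm_6_5_dim2 : ¬ MSP21_thm_6_5_dim2 := by
  classical
  intro hMSP
  obtain ⟨P, hP, S, hSsub, hSci, hScard⟩ :=
    Literature.Computability.AlgebraicComplexity.KPTT.kptt_proposition1_holds 14 2 le_rfl
  -- enumerate the classes: `pt k i`, `i : Fin 8`
  have hP8 : ∀ k, (P k).card = 8 := fun k => by rw [hP k]; norm_num
  let enum : ∀ k : Fin 14, Fin 8 ≃ ↥(P k) := fun k => (finCongr (hP8 k).symm).trans (P k).equivFin.symm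
  let pt : Fin 14 → Fin 8 → (Fin 2 → ℝ) := fun k i => (enum k i : Fin 2 → ℝ)
  have hpt_mem : ∀ k i, pt k i ∈ P k := fun k i => (enum k i).2
  have hpt_inj : ∀ k, Function.Injective (pt k) := fun k i i' h =>
    (enum k).injective (Subtype.ext h)
  -- separating translations with total `0`
  let R : ℝ := ∑ k : Fin 14, ∑ p ∈ P k, ‖p‖
  have hR : ∀ k, ∀ p ∈ P k, ‖p‖ ≤ R := by
    intro k p hp
    calc ‖p‖ ≤ ∑ q ∈ P k, ‖q‖ := Finset.single_le_sum (fun q _ => norm_nonneg q) hp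
      _ ≤ R := Finset.single_le_sum (fun k _ => Finset.sum_nonneg fun q _ => norm_nonneg q) (Finset.mem_univ k)
  let M : ℝ := 2 * R + 1
  have hM : 0 < M := by
    have : 0 ≤ R := Finset.sum_nonneg fun k _ => Finset.sum_nonneg fun q _ => norm_nonneg q
    simp only [M]; linarith
  let c : Fin 14 → (Fin 2 → ℝ) := fun k => ![M * ((k : ℝ) - 13 / 2), 0]
  have hcsum : ∑ k, c k = 0 := by
    funext i
    rw [Finset.sum_apply]
    fin_cases i
    · simp only [c]
      simp [Fin.sum_univ_succ]
      ring
    · simp [c]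
  -- the vertices `Fin 112 ≃ Fin 14 × Fin 8` and the embedding
  let eqv : Fin 14 × Fin 8 ≃ Fin 112 := finProdFinEquiv.trans (finCongr (by norm_num))
  let vx : Fin 14 → Fin 8 → Fin 112 := fun k i => eqv (k, i)
  let f : Fin 112 → (Fin 2 → ℝ) := fun w => pt (eqv.symm w).1 (eqv.symm w).2 + c (eqv.symm w).1
  have hf_vx : ∀ k i, f (vx k i) = pt k i + c k := fun k i => by simp [f, vx]
  have hf_inj : Function.Injective f := by
    intro w w' h
    obtain ⟨⟨k, i⟩, rfl⟩ := eqv.surjective w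
    obtain ⟨⟨k', i'⟩, rfl⟩ := eqv.surjective w'
    change f (vx k i) = f (vx k' i') at h
    rw [hf_vx, hf_vx] at h
    have h0 := congrFun h 0
    simp only [Pi.add_apply, c, Matrix.cons_val_zero] at h0
    -- `|pt k i 0 - pt k' i' 0| ≤ 2R < M`, so the classes agree
    have hb1 : |pt k i 0| ≤ R := (norm_le_pi_norm (pt k i) 0).trans (hR k _ (hpt_mem k i))
    have hb2 : |pt k' i' 0| ≤ R := (norm_le_pi_norm (pt k' i') 0).trans (hR k' _ (hpt_mem k' i'))
    have hkk : (k : ℝ) = k' := by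
      by_contra hne
      have hdiff : M * ((k : ℝ) - k') = pt k' i' 0 - pt k i 0 := by linarith
      have h1 : (1 : ℝ) ≤ |(k : ℝ) - k'| := by
        have hz : ((k : ℤ) : ℝ) - ((k' : ℤ) : ℝ) = (((k : ℤ) - (k' : ℤ) : ℤ) : ℝ) := by push_cast; ring
        have hne' : (k : ℤ) ≠ (k' : ℤ) := fun h => hne (by exact_mod_cast h)
        have : (1 : ℤ) ≤ |(k : ℤ) - (k' : ℤ)| := Int.one_le_abs (sub_ne_zero.2 hne')
        have hcast : ((k : ℕ) : ℝ) = ((k : ℤ) : ℝ) := by simp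
        have hcast' : ((k' : ℕ) : ℝ) = ((k' : ℤ) : ℝ) := by simp
        rw [hcast, hcast', hz, ← Int.cast_abs]
        exact_mod_cast this
      have h2 : |M * ((k : ℝ) - k')| ≤ 2 * R := by
        rw [hdiff]
        calc |pt k' i' 0 - pt k i 0| ≤ |pt k' i' 0| + |pt k i 0| := abs_sub _ _
          _ ≤ R + R := add_le_add hb2 hb1
          _ = 2 * R := by ring
      rw [abs_mul, abs_of_pos hM] at h2
      have h3 : M * 1 ≤ M * |(k : ℝ) - k'| := mul_le_mul_of_nonneg_left h1 hM.le
      simp only [M] at h2 h3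
      linarith
    have hk : k = k' := Fin.ext (by exact_mod_cast hkk)
    subst hk
    have hpi : pt k i = pt k i' := by
      have : pt k i + c k = pt k i' + c k := h
      exact add_right_cancel this
    rw [hpt_inj k hpi]
  -- one transversal hyperedge per point of `S`
  have hdec : ∀ s ∈ S, ∃ g : Fin 14 → Fin 8, ∑ k, pt k (g k) = s := by
    intro s hs
    have hs' : (s : Fin 2 → ℝ) ∈ ((∑ k, P k : Finset (Fin 2 → ℝ)) : Set (Fin 2 → ℝ)) := hSsub hs
    rw [Finset.coe_sum] at hs'
    obtain ⟨g, hg, hgs⟩ := (Set.mem_fintype_sum _ _).1 hs'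
    refine ⟨fun k => (enum k).symm ⟨g k, hg k⟩, ?_⟩
    rw [← hgs]
    refine Finset.sum_congr rfl fun k _ => ?_
    simp only [pt, Equiv.apply_symm_apply]
  choose! g hg using hdec
  let edge : (Fin 2 → ℝ) → Finset (Fin 112) := fun s => Finset.univ.image fun k => vx k (g s k)
  have hvx_inj : ∀ s, Function.Injective fun k => vx k (g s k) := by
    intro s k k' h
    have := congrArg Prod.fst (eqv.injective h)
    exact this
  have hedge_card : ∀ s, (edge s).card = 14 := fun s => by
    rw [Finset.card_image_of_injective _ (hvx_inj s)]; simp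
  have hedge_sum : ∀ s ∈ S, ∑ w ∈ edge s, f w = s := by
    intro s hs
    rw [Finset.sum_image fun k _ k' _ h => hvx_inj s h]
    simp_rw [hf_vx]
    rw [Finset.sum_add_distrib, hcsum, add_zero, hg s hs]
  have hedge_inj : ∀ s ∈ S, ∀ s' ∈ S, edge s = edge s' → s = s' := by
    intro s hs s' hs' h
    rw [← hedge_sum s hs, ← hedge_sum s' hs', h]
  let E : Finset (Finset (Fin 112)) := S.image edge
  have hEcard : E.card = S.card := Finset.card_image_of_injOn fun s hs s' hs' h => hedge_inj s hs s' hs' h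
  have hEunif : ∀ e ∈ E, e.card = 14 := by
    intro e he
    obtain ⟨s, -, rfl⟩ := Finset.mem_image.1 he
    exact hedge_card s
  -- the barycentres are `(1/14) • S`, pairwise distinct
  let bary : Finset (Fin 112) → (Fin 2 → ℝ) := fun e => ((14 : ℕ) : ℝ)⁻¹ • ∑ v ∈ e, f v
  have hbary_edge : ∀ s ∈ S, bary (edge s) = ((14 : ℕ) : ℝ)⁻¹ • s := fun s hs => by
    simp only [bary, hedge_sum s hs]
  have hbary : (E.image bary) = S.image fun s => ((14 : ℕ) : ℝ)⁻¹ • s := by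
    ext y
    simp only [E, Finset.mem_image, exists_exists_and_eq_and]
    constructor
    · rintro ⟨s, hs, rfl⟩; exact ⟨s, hs, (hbary_edge s hs).symm⟩
    · rintro ⟨s, hs, rfl⟩; exact ⟨s, hs, hbary_edge s hs⟩
  have hcoe : ((S.image fun s => ((14 : ℕ) : ℝ)⁻¹ • s : Finset (Fin 2 → ℝ)) : Set (Fin 2 → ℝ)) =
      ((14 : ℕ) : ℝ)⁻¹ • (S : Set (Fin 2 → ℝ)) := by
    rw [Finset.coe_image, Set.image_smul]
  have hci_set : ConvexIndependent ℝ (Subtype.val : ↥((E.image bary : Finset (Fin 2 → ℝ)) : Set (Fin 2 → ℝ)) → (Fin 2 → ℝ)) := by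
    rw [hbary, hcoe]
    exact convexIndependent_smul hSci (by norm_num)
  -- family form: the barycentre map is injective on `E`
  have hp_inj : Function.Injective (fun e : ↥E => bary e) := by
    rintro ⟨e, he⟩ ⟨e', he'⟩ h
    obtain ⟨s, hs, rfl⟩ := Finset.mem_image.1 he
    obtain ⟨s', hs', rfl⟩ := Finset.mem_image.1 he'
    have h' : ((14 : ℕ) : ℝ)⁻¹ • s = ((14 : ℕ) : ℝ)⁻¹ • s' := by
      rw [← hbary_edge s hs, ← hbary_edge s' hs']; exact h
    have hss : s = s' := smul_right_injective _ (by norm_num) h'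
    subst hss
    rfl
  have hrange : Set.range (fun e : ↥E => bary e) = ((E.image bary : Finset (Fin 2 → ℝ)) : Set (Fin 2 → ℝ)) := by
    ext y
    simp only [Set.mem_range, Finset.coe_image, Set.mem_image, Finset.mem_coe, Subtype.exists, exists_prop]
  have hci : ConvexIndependent ℝ (fun e : ↥E => bary e) := by
    rw [← hp_inj.convexIndependent_iff_set, hrange]
    exact hci_set
  have hbound := hMSP 112 14 E hEunif f hf_inj hci
  rw [hEcard] at hbound
  have h16383 : (2 : ℕ) ^ 14 - 1 = 16383 := by norm_num
  have h12434 : 2 * ((112 - 1).choose 2 + (112 - 1).choose 1 + (112 - 1).choose 0) = 12434 := by decide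
  omega

end Summit.ValiantsHypothesis.ValiantsHypothesis.Theorems.NewtonUnitEquations.TwoProducts.MSP21

end
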